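/-
Copyright: statement-level skeleton of a published paper (lit-balaban cell, Phase-2 proof seat p19). No proof claims beyond
what the kernel checks below.
-/
import Literature.MathematicalPhysics.QuantumFieldTheory.Balaban1983to89.B3Cor23Concrete
import Literature.MathematicalPhysics.QuantumFieldTheory.Balaban1983to89.B3Ineq217Proof

/-!
# `Balaban1983to89.B3Ineq217Concrete` — T. Bałaban, *(Higgs)₂,₃ quantum fields in a finite volume. III. Renormalization*,
Commun. Math. Phys. **88** (1983) 411–445 [Balaban1983Higgs3]: the estimate **(2.17)** p. 429 on the concrete graphs of the
expansion WITH THE LEGS OF THE EXTERNAL VECTOR FIELD Ã COUNTED AMONG THE EXTERNAL LEGS, PROVED for every d ≤ 4, and the knitting of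
the vertex-local form (`…B3Ineq217Proof`) to the concrete carrier (`…B3Cor23Concrete`)

statement-level skeleton of published theorems with citation tags; proofs where landed; nothing here is a claim about the Yang–Mills mass gap

PDF held: `paper:balaban1983-higgs-2-3-quantum-fields-finite-volume` (journal page = PDF page + 410).  Renders read as images for
every quotation below: `run/shared/lean/pub/pub-balaban/b2b-balaban-ref1/pages/1983-cmp88-higgs23-III/1983-cmp88-higgs23-III-p005,
p012, p013, p019, p020-x4.png` (journal pp. 415, 422, 423, 429, 430).

CITATION HEADER (lean-in-tree rule).  Phase-2 file of the lit-balaban TYPED SKELETON (HOME `run/shared/lean/pub/lit-balaban/`), seat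
p19, SKELETON row **B3.Eq2.17** (decl of record `B3Sect2Statements.Ineq217 (d) (F : GraphFamily)`, an abstract carrier; ruling
G.5-27a: p19 files the concrete instance under this stem).  The tree already holds (2.17) twice: for VERTEX-LOCAL data
(`B3Ineq217Proof.ineq217_graphDegree`, reader r15) and for the CONCRETE graphs `B3Cor23Concrete.Graph n̄` of the catalogue
(1.6)–(1.15) (`B3Cor23ConcreteProof.ineq217_holds`, seat p18, 2 ≤ d ≤ 4) — both with "(a number of external legs)" read as the
φ′- and A′-legs of the vertices not lying on internal lines (`B3Cor23Concrete.Graph.numExtLegs`, `B3Ineq217Proof.extLegs`), the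
legs of the external vector field Ã being left out (*"external fields have a dimension equal to 0"*, p. 422).  WHAT THIS FILE ADDS,
on p18's carrier (no new carrier): (a) the count `numExtLegsAll` = those legs PLUS the Ã-legs of the vertices — the reading of the
legend (1.17) p. 415, which has ONE symbol for *"an external vector field, or a leg in a vertex"* (and one for *"an external scalar
field, or a leg in a vertex"*), and of p. 430, where (2.17) is applied to *"graphs with two external vector field legs"* (*"these
graphs have at most four vertices again"*) — and the corresponding instance `familyAll d n̄` of the abstract carrier (p18's
`family d n̄` with this count); (b) **(2.17) PROVED for `familyAll d n̄` in every dimension d ≤ 4** (`ineq217All_holds`; per graph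
`rhs217_le_deg`): for d > 2 this is the STRONGER inequality (more legs counted, `numExtLegs_le_numExtLegsAll`), and it is TIGHT
on the basic vacuum-polarization graph — two vertices (1.8) with n = 0, n′ = 1 whose φ′-legs are joined into a loop: D = −1 =
the right side with its two Ã-legs counted (d = 3), against −2 without them (`vacPol18_deg`); the proof is the printed
bookkeeping: the table (i)–(iv) p. 423 survives counting the Ã-legs of (1.8)–(1.11) with the leg dimension −(d−2)/2
(`allLegs_count_ge`: the count is (n+n′)(4−d)/2 ≥ (4−d)/2 for n + n′ ≥ 1, d ≤ 4), whence D_G(v) ≥ (4−d)/2 + (all external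
legs at v)(d−2)/2 for every vertex not of the form (1.13)–(1.15) (`vertexDeg_ge`), summed over the vertices ((2.2):
`B3Cor23Concrete.Graph.deg_eq`); the printed right side −2(d−2)/2 − 1 + (V−1)(4−d)/2 + (E−1)(d−2)/2 is V(4−d)/2 + E(d−2)/2 − d
(`B3Ineq217Proof.rhs217_eq`); (c) KNITTING: the vertex-local external-leg count of r15 evaluated on the vertex data of a
concrete graph IS p18's count (`extLegs_vertexData_eq`), so `B3Ineq217Proof.ineq217_of_realization` instantiates on
`B3Cor23Concrete.family` (the `example` after it; the resulting statement is p18's `ineq217_holds` and is not re-declared).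
DELIBERATELY NOT HERE: a second graph carrier (an earlier version of this seat's work, p243151, carried its own `FeynGraph`
model; withdrawn in favour of p18's `Graph`); the inductive clause of (2.3) (p. 423 reduces it to (2.2) by attaching graphs —
more vertices, same external legs; `B3Ineq217Proof.rhs217_mono_vertices`); Corollary 2.3 (p18).  (2.17) is false for d ≥ 5
(two vertices (1.6) joined by four lines: D = −7 < −6), whence `d ≤ 4`; the paper has d = 2, 3.  Unit `lit-balaban-p19`.
-/

namespace Literature.MathematicalPhysics.QuantumFieldTheory.Balaban1983to89.B3Ineq217Concrete

open Finset B3Prop1 B3Sect2Statements B3VertexBridge B3Cor23Concrete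

variable {nbar : ℕ}

/-! ## External legs with the Ã-legs counted -/

/-- ALL external legs at the vertex `i` of a concrete graph: its φ′- and A′-legs not lying on internal lines
(`B3Cor23Concrete.Graph.extLegs`) plus its legs of the external vector field Ã (`VertexKind.extVectorLegs`), which never lie on
internal lines — legend (1.17) p. 415: *"an external vector field, or a leg in a vertex"*. [cite: Balaban1983Higgs3, (1.17) p.415] -/
def extLegsAll (G : Graph nbar) (i : Fin G.nV) : ℕ :=
  G.extLegs i + (G.kind i).extVectorLegs

/-- "(a number of external legs)" of (2.17) with the Ã-legs counted: Σ_v `extLegsAll`. [cite: Balaban1983Higgs3, (2.17) p.429] -/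
def numExtLegsAll (G : Graph nbar) : ℕ :=
  ∑ i, extLegsAll G i

/-- kernel: the count with Ã-legs = p18's count + the number of Ã-legs. [cite: Balaban1983Higgs3, (2.17) p.429] -/
theorem numExtLegsAll_eq (G : Graph nbar) : numExtLegsAll G = G.numExtLegs + ∑ i, (G.kind i).extVectorLegs := by
  unfold numExtLegsAll extLegsAll Graph.numExtLegs
  rw [Finset.sum_add_distrib]

/-- kernel: counting the Ã-legs can only increase the number of external legs. [cite: Balaban1983Higgs3, (2.17) p.429] -/
theorem numExtLegs_le_numExtLegsAll (G : Graph nbar) : G.numExtLegs ≤ numExtLegsAll G := by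
  rw [numExtLegsAll_eq]
  exact Nat.le_add_right _ _

/-- The instance of the abstract carrier `B3Sect2Statements.GraphFamily` given by p18's concrete graphs `B3Cor23Concrete.Graph n̄`
in dimension d with the external legs counted INCLUDING the Ã-legs (all other fields as in `B3Cor23Concrete.family`).
[cite: Balaban1983Higgs3, (2.17) p.429] -/
def familyAll (d nbar : ℕ) : GraphFamily where
  Graph := Graph nbar
  numVertices G := G.nV
  numExtLegs G := numExtLegsAll G
  degree G := G.deg d
  hasVertex1315 G := G.HasVertex1315
  hasRVertex G := G.HasRVertex
  hasFiniteCounterterm G := G.HasFiniteCounterterm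

/-! ## The per-vertex estimate with the Ã-legs counted -/

/-- kernel: a catalogue vertex not of the form (1.13)–(1.15) is not of the form (1.14)–(1.15) (no extra summand in (2.1)).
[cite: Balaban1983Higgs3, (2.1) p.422] -/
theorem isAveragingVertex_eq_false {K : VertexKind} (h : K.isOfForm1315 = false) : K.isAveragingVertex = false := by
  cases K <;> simp_all [VertexKind.isOfForm1315, VertexKind.isAveragingVertex]

/-- The table (i)–(iv) p. 423 in the form the Ã-inclusive (2.17) consumes: for every admissible vertex of (1.6)–(1.11) and
d ≤ 4, counting ALL its legs — φ′, A′ AND Ã — with the leg dimension −(d−2)/2, (η-factors) + (all legs)(2−d)/2 −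
(differentiations) ≥ (4−d)/2: it is 4 − d for (1.6), 2 for (1.7), and (n+n′)(4−d)/2 with n + n′ ≥ 1 for (1.8)–(1.11) (print:
D(v₃) = D(v₄) = n(4−d)/2 + n′ ≥ (4−d)/2, the Ã-legs entering only through η^{n′}). [cite: Balaban1983Higgs3, p.423] -/
theorem allLegs_count_ge (d nbar : ℕ) (hd : d ≤ 4) (K : VertexKind) (hK : K.Admissible nbar) (h1315 : K.isOfForm1315 = false) :
    (4 - (d : ℚ)) / 2 ≤ (K.etaCount d : ℚ) + ((K.scalarLegs : ℚ) + K.vectorLegs + K.extVectorLegs) * ((2 - (d : ℚ)) / 2)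
      - K.diffCount := by
  have hd' : (d : ℚ) ≤ 4 := by exact_mod_cast hd
  have hd0 : (0 : ℚ) ≤ d := by positivity
  cases K with
  | v16 => simp [VertexKind.etaCount, VertexKind.scalarLegs, VertexKind.vectorLegs, VertexKind.extVectorLegs,
      VertexKind.diffCount]; linarith
  | v17 => simp [VertexKind.etaCount, VertexKind.scalarLegs, VertexKind.vectorLegs, VertexKind.extVectorLegs,
      VertexKind.diffCount]; linarith
  | v18 n n' =>
    obtain ⟨-, -, h1⟩ := hK
    have h1' : (1 : ℚ) ≤ n + n' := by exact_mod_cast h1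
    simp [VertexKind.etaCount, VertexKind.scalarLegs, VertexKind.vectorLegs, VertexKind.extVectorLegs, VertexKind.diffCount]
    nlinarith [mul_nonneg (sub_nonneg.mpr h1') (sub_nonneg.mpr hd')]
  | v19 n nb =>
    have h0 : (0 : ℚ) ≤ n + nb := by positivity
    simp [VertexKind.etaCount, VertexKind.scalarLegs, VertexKind.vectorLegs, VertexKind.extVectorLegs, VertexKind.diffCount]
    nlinarith [mul_nonneg h0 (sub_nonneg.mpr hd')]
  | v110 n n' =>
    obtain ⟨-, -, -, h2⟩ := hK
    have h2' : (2 : ℚ) ≤ n + n' := by exact_mod_cast h2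
    simp [VertexKind.etaCount, VertexKind.scalarLegs, VertexKind.vectorLegs, VertexKind.extVectorLegs, VertexKind.diffCount]
    nlinarith [mul_nonneg (by linarith : (0 : ℚ) ≤ n + n' - 1) (sub_nonneg.mpr hd')]
  | v111 n nb =>
    have h0 : (0 : ℚ) ≤ n + nb := by positivity
    simp [VertexKind.etaCount, VertexKind.scalarLegs, VertexKind.vectorLegs, VertexKind.extVectorLegs, VertexKind.diffCount]
    nlinarith [mul_nonneg h0 (sub_nonneg.mpr hd')]
  | v113 => simp [VertexKind.isOfForm1315] at h1315
  | v114 n n' => simp [VertexKind.isOfForm1315] at h1315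
  | v115 n nb => simp [VertexKind.isOfForm1315] at h1315

/-- The per-vertex estimate behind the Ã-inclusive (2.17), pp. 422–423: for a vertex v of a concrete graph G not of the form
(1.13)–(1.15), in dimension d ≤ 4, D_G(v) ≥ (4−d)/2 + (ALL external legs at v)·(d−2)/2 — from `allLegs_count_ge` and (2.1)
(a differentiation not acting on an internal line only raises D_G(v)). [cite: Balaban1983Higgs3, (2.1) p.422] -/
theorem vertexDeg_ge (d : ℕ) (hd : d ≤ 4) (G : Graph nbar) (i : Fin G.nV) (h1315 : (G.kind i).isOfForm1315 = false) :
    (4 - (d : ℚ)) / 2 + (extLegsAll G i : ℚ) * (((d : ℚ) - 2) / 2) ≤ G.vertexDeg d i := by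
  have hav : (G.kind i).isAveragingVertex = false := isAveragingVertex_eq_false h1315
  have hall := allLegs_count_ge d nbar hd (G.kind i) (G.adm i) h1315
  have hδ : (G.intDiffs i : ℚ) ≤ (G.kind i).diffCount := by exact_mod_cast G.intDiffs_le i
  have hext : (extLegsAll G i : ℚ) = (((G.kind i).scalarLegs : ℚ) - G.intScalar i)
      + (((G.kind i).vectorLegs : ℚ) - G.intVector i) + (G.kind i).extVectorLegs := by
    unfold extLegsAll Graph.extLegs
    push_cast [Nat.cast_sub (G.intScalar_le i), Nat.cast_sub (G.intVector_le i)]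
    ring
  rw [hext, G.vertexDeg_eq]
  simp only [hav, Bool.false_eq_true, if_false, add_zero]
  push_cast
  linarith

/-! ## (2.17) with the Ã-legs counted -/

/-- **(2.17)** p. 429 [PDF 19] for ONE concrete graph, with the Ã-legs counted among the external legs, verbatim: *"For the graphs G
which do not contain vertices of the form (1.13)–(1.15) we can easily prove the following estimate D(G) ≥ −2(d−2)/2 − 1 + ((a
number of vertices) − 1)(4−d)/2 + ((a number of external legs) − 1)(d−2)/2, (2.17)"* — PROVED for every `G : B3Cor23Concrete.Graph n̄`
without vertices (1.13)–(1.15), every d ≤ 4, D(G) = `G.deg d` ((2.1)–(2.2)), E = `numExtLegsAll G`: the per-vertex estimate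
`vertexDeg_ge` summed over the vertices. [cite: Balaban1983Higgs3, (2.17) p.429] -/
theorem rhs217_le_deg (d : ℕ) (hd : d ≤ 4) (G : Graph nbar) (hG : ¬ G.HasVertex1315) :
    -2 * (((d : ℚ) - 2) / 2) - 1 + ((G.nV : ℚ) - 1) * ((4 - (d : ℚ)) / 2)
        + ((numExtLegsAll G : ℚ) - 1) * (((d : ℚ) - 2) / 2) ≤ G.deg d := by
  have h1315 : ∀ i, (G.kind i).isOfForm1315 = false := by
    intro i
    by_contra h
    exact hG ⟨i, by simpa using h⟩
  have hsum : (G.nV : ℚ) * ((4 - (d : ℚ)) / 2) + (∑ i, (extLegsAll G i : ℚ)) * (((d : ℚ) - 2) / 2)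
      ≤ ∑ i, G.vertexDeg d i := by
    calc (G.nV : ℚ) * ((4 - (d : ℚ)) / 2) + (∑ i, (extLegsAll G i : ℚ)) * (((d : ℚ) - 2) / 2)
        = ∑ i : Fin G.nV, ((4 - (d : ℚ)) / 2 + (extLegsAll G i : ℚ) * (((d : ℚ) - 2) / 2)) := by
          rw [Finset.sum_add_distrib, Finset.sum_const, Finset.card_univ, Fintype.card_fin, Finset.sum_mul, nsmul_eq_mul]
      _ ≤ ∑ i, G.vertexDeg d i := Finset.sum_le_sum fun i _ => vertexDeg_ge d hd G i (h1315 i)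
  have hE : (numExtLegsAll G : ℚ) = ∑ i, (extLegsAll G i : ℚ) := by
    unfold numExtLegsAll
    push_cast
    rfl
  rw [G.deg_eq, hE]
  linarith

/-- **(2.17)** p. 429 [PDF 19] AS TYPED (`B3Sect2Statements.Ineq217`), PROVED for the instance `familyAll d n̄` (p18's concrete
graphs, external legs counted WITH the Ã-legs) in every dimension d ≤ 4 and for every n̄, verbatim: *"For the graphs G which do
not contain vertices of the form (1.13)–(1.15) we can easily prove the following estimate D(G) ≥ −2(d−2)/2 − 1 + ((a number of
vertices) − 1)(4−d)/2 + ((a number of external legs) − 1)(d−2)/2, (2.17)"* ("easily prove": no printed proof; here `rhs217_le_deg`).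
[cite: Balaban1983Higgs3, (2.17) p.429] -/
theorem ineq217All_holds (d nbar : ℕ) (hd : d ≤ 4) : Ineq217 d (familyAll d nbar) := by
  intro G hG
  exact rhs217_le_deg d hd G hG

/-- **(2.17)** with the Ã-legs counted, d = 3 (the (Higgs)₃ model), no side condition. [cite: Balaban1983Higgs3, (2.17) p.429] -/
theorem ineq217All_holds_d3 (nbar : ℕ) : Ineq217 3 (familyAll 3 nbar) :=
  ineq217All_holds 3 nbar (by norm_num)

/-- **(2.17)** with the Ã-legs counted, d = 2 (the (Higgs)₂ model), no side condition. [cite: Balaban1983Higgs3, (2.17) p.429] -/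
theorem ineq217All_holds_d2 (nbar : ℕ) : Ineq217 2 (familyAll 2 nbar) :=
  ineq217All_holds 2 nbar (by norm_num)

/-! ## Tightness: the vacuum-polarization graph of p. 430 -/

/-- The basic graph *"with two external vector field legs"* (p. 430): two vertices (1.8) with n = 0, n′ = 1 (one Ã-leg each) whose
two φ′-legs are joined crosswise by two scalar lines (a scalar loop); admissible for n̄ ≥ 1. [cite: Balaban1983Higgs3, p.430] -/
def vacPol18 (nbar : ℕ) (hn : 1 ≤ nbar) : Graph nbar where
  nV := 2
  kind _ := .v18 0 1
  adm _ := by simp [VertexKind.Admissible, hn]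
  other x := match x with
    | ⟨0, .inl j⟩ => some ⟨1, .inl ⟨j.val, j.isLt⟩⟩
    | ⟨1, .inl j⟩ => some ⟨0, .inl ⟨j.val, j.isLt⟩⟩
    | ⟨0, .inr j⟩ => j.elim0
    | ⟨1, .inr j⟩ => j.elim0
  other_ne := by decide
  other_symm := by decide
  other_isLeft := by decide
  exists_line := by decide

/-- kernel: `vacPol18` has NO external φ′/A′-leg (p18's count 0), TWO external legs with the Ã-legs counted, and D = 2·D_G(v₃) − 3
= 2·1 − 3 = −1 in d = 3 (each vertex: η³, two internal φ′-legs, the differentiation internal: 3 − 1 − 1 = 1) — which IS the right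
side of (2.17) for V = 2, E = 2, d = 3 ((V + E − 6)/2 = −1; `B3Sect2Statements.rhs217_d3`), while E = 0 would give −2: the
Ã-inclusive (2.17) is tight here, and it is the bound print uses for these graphs (p. 430: *"at most four vertices"*).
[cite: Balaban1983Higgs3, (2.17) p.429] -/
theorem vacPol18_deg (nbar : ℕ) (hn : 1 ≤ nbar) :
    (vacPol18 nbar hn).numExtLegs = 0 ∧ numExtLegsAll (vacPol18 nbar hn) = 2 ∧ (vacPol18 nbar hn).deg 3 = -1 := by
  refine ⟨by rfl, by rfl, ?_⟩
  have a0 : (vacPol18 nbar hn).intScalar (0 : Fin 2) = 2 := by rfl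
  have b0 : (vacPol18 nbar hn).intVector (0 : Fin 2) = 0 := by rfl
  have c0 : (vacPol18 nbar hn).intDiffs (0 : Fin 2) = 1 := by rfl
  have a1 : (vacPol18 nbar hn).intScalar (1 : Fin 2) = 2 := by rfl
  have b1 : (vacPol18 nbar hn).intVector (1 : Fin 2) = 0 := by rfl
  have c1 : (vacPol18 nbar hn).intDiffs (1 : Fin 2) = 1 := by rfl
  rw [Graph.deg_eq]
  change (∑ i : Fin 2, (vacPol18 nbar hn).vertexDeg 3 i) - 3 = (-1 : ℚ)
  rw [Fin.sum_univ_two, Graph.vertexDeg_eq, Graph.vertexDeg_eq, a0, b0, c0, a1, b1, c1]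
  simp [vacPol18, VertexKind.etaCount, VertexKind.isAveragingVertex]
  norm_num

/-! ## Knitting: the vertex-local form `B3Ineq217Proof` on the concrete carrier -/

/-- kernel: r15's vertex-local external-leg count `B3Ineq217Proof.extLegs`, evaluated on the vertex data (2.1) of a concrete graph,
is p18's `Graph.numExtLegs` (both: φ′- and A′-legs not on internal lines). [cite: Balaban1983Higgs3, (2.17) p.429] -/
theorem extLegs_vertexData_eq (d : ℕ) (G : Graph nbar) :
    B3Ineq217Proof.extLegs univ (G.vertexData d) = G.numExtLegs := by
  unfold B3Ineq217Proof.extLegs Graph.numExtLegs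
  refine Finset.sum_congr rfl fun i _ => ?_
  have hs := G.intScalar_le i
  have hv := G.intVector_le i
  show (G.kind i).scalarLegs + (G.kind i).vectorLegs - (G.intScalar i + G.intVector i)
    = (G.kind i).scalarLegs - G.intScalar i + ((G.kind i).vectorLegs - G.intVector i)
  omega

/- The realization route of `B3Ineq217Proof.ineq217_of_realization` instantiates on p18's family (2 ≤ d ≤ 4): each concrete graph
is realized by its own vertex data, the hypothesis "D(v) ≥ (4−d)/2" being `B3VertexBridge.degree_toCounts_ge`.  The resulting
statement is `B3Cor23ConcreteProof.ineq217_holds` (already in the tree) and is therefore not re-declared; this `example` records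
that the two files compose. -/
example (d : ℕ) (hd2 : 2 ≤ d) (hd4 : d ≤ 4) (nbar : ℕ) : Ineq217 d (family d nbar) :=
  B3Ineq217Proof.ineq217_of_realization d hd2 (family d nbar) fun G hG =>
    ⟨Fin G.nV, univ, G.vertexData d,
      fun i _ => isAveragingVertex_eq_false (by
        by_contra h
        exact hG ⟨i, by simpa using h⟩),
      fun _ _ => le_rfl,
      fun i _ => degree_toCounts_ge d hd2 hd4 nbar (G.kind i) (G.adm i),
      by simp [family], (extLegs_vertexData_eq d G).symm, rfl⟩

end Literature.MathematicalPhysics.QuantumFieldTheory.Balaban1983to89.B3Ineq217Concrete
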